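import Summits.NavierStokesRegularity.NavierStokesRegularity.Theorems.RecurrentProfilesRecurrentReductionOrbit
import HarnessLib

/-!
# Crux `RecurrentLiouville` (stmt-NavierStokesRegularity-1589), line `Sketch` — stub `stub_rlOrbitContinuous`:
# the scaling orbit is continuous in `L³` on the backward balls

Theorems-only file (no definitions, no named facts), pure real analysis.  For a space–time field
`u : ℝ → ℝ³ → ℝ³` lying in `L³(Q(0, R))` for every `R > 0` (`Q(0, R) = ]-R², 0[ × B(0, R)`), the
Navier–Stokes scaling orbit `c ↦ u_c`, `u_c(t, x) = c u(c² t, c x)` (`nsRescale c u`), is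
continuous at `c = 1` in `L³(Q(0, R))`: `‖u_c − u‖_{L³(Q(0,R))} → 0` as `c → 1`
(`stub_rlOrbitContinuous`), i.e. the parabolic dilation group acts strongly continuously on
`L³_loc` of the backward slab.

Proof (the classical `3ε` argument for the continuity of translations/dilations in `L^p`):
truncate `u` to `Q(0, 2R)` and approximate the truncation `f` in `L³(ℝ × ℝ³)` by a continuous
compactly supported `g` (Mathlib's `MemLp.exists_hasCompactSupport_eLpNorm_sub_le`); for
`c ∈ (1/2, 2)` split `u_c − u = (u_c − g_c) + (g_c − g) + (g − u)` on `Q(0, R)`.  The first term is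
`c (c⁵)^{-1/3} ‖u − g‖_{L³(Q(0, cR))} ≤ 2 · 32^{1/3} ‖f − g‖_{L³}` by the exact scaling law
(`nsRescale_eq_zoom`, `eLpNorm_zoom_sub_zoom`) and `Q(0, cR) ⊆ Q(0, 2R)`, the last is
`≤ ‖f − g‖_{L³}`, and the middle one is small uniformly on `Q(0, R)` for `c` near `1` because `g`
is bounded and uniformly continuous (`rlOrbitContinuous_uniform`), whence small in `L³(Q(0, R))`
by `eLpNorm_le_of_ae_bound` on the finite-measure ball.

## References

* W. Rudin, *Real and Complex Analysis*, 3rd ed., Thm. 9.5 (continuity of translation in `L^p`).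
  [folklore]
-/

noncomputable section

-- the sub-problem namespace repeats the summit name (D-0017 layout `Summit.<S>.<P>.Theorems`)
set_option linter.dupNamespace false

namespace Summit.NavierStokesRegularity.NavierStokesRegularity.Theorems

open MeasureTheory Set Function Filter Topology TopologicalSpace Metric
open Literature.Analysis.FluidPDE
open scoped NNReal ENNReal

/-- The scaling constant `c (c⁵)^{-1/3}` of the exact `L³` scaling law is at most `2 · 32^{1/3}`
for `c ∈ (1/2, 2)`. [folklore] -/
theorem rlOrbitContinuous_zoomConst_le {c : ℝ} (hc : c ∈ Ioo (1 / 2 : ℝ) 2) :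
    ‖c‖ₑ * (ENNReal.ofReal (c ^ 2 * c ^ 3)⁻¹) ^ (1 / (3 : ℝ≥0∞).toReal) ≤
      ENNReal.ofReal 2 * ENNReal.ofReal 32 ^ (1 / (3 : ℝ≥0∞).toReal) := by
  have hc0 : 0 < c := by linarith [hc.1]
  refine mul_le_mul' ?_ ?_
  · rw [Real.enorm_eq_ofReal hc0.le]
    exact ENNReal.ofReal_le_ofReal hc.2.le
  · refine ENNReal.rpow_le_rpow (ENNReal.ofReal_le_ofReal ?_) (by norm_num)
    have h5 : (1 / 2 : ℝ) ^ 5 ≤ c ^ 5 := pow_le_pow_left₀ (by norm_num) hc.1.le 5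
    calc (c ^ 2 * c ^ 3)⁻¹ = (c ^ 5)⁻¹ := by ring
      _ ≤ ((1 / 2 : ℝ) ^ 5)⁻¹ := inv_anti₀ (by norm_num) h5
      _ = 32 := by norm_num

/-- **Uniform smallness of `c g(c² t, c x) − g(t, x)` on a backward ball.**  For a continuous
compactly supported `g` on `ℝ × ℝ³`, `R > 0` and `η > 0`, every `c` close enough to `1` satisfies
`‖c g(c² t, c x) − g(t, x)‖ ≤ η` for all `(t, x) ∈ Q(0, R)`: `g` is bounded by `B`, so
`‖(c − 1) g(c² t, c x)‖ ≤ |c − 1| B`, and uniformly continuous, while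
`dist ((c² t, c x), (t, x)) ≤ |c − 1| (3R² + R)` on `Q(0, R)` for `|c − 1| ≤ 1`. [folklore] -/
theorem rlOrbitContinuous_uniform
    {g : ℝ × EuclideanSpace ℝ (Fin 3) → EuclideanSpace ℝ (Fin 3)} (hg : Continuous g)
    (hgs : HasCompactSupport g) {R : ℝ} (hR : 0 < R) {η : ℝ} (hη : 0 < η) :
    ∀ᶠ c : ℝ in 𝓝 1, ∀ z ∈ parabolicCylinder R (0 : ℝ × EuclideanSpace ℝ (Fin 3)),
      ‖c • g (c ^ 2 * z.1, c • z.2) - g z‖ ≤ η := by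
  obtain ⟨B, hB⟩ := hg.bounded_above_of_compact_support hgs
  have hB0 : 0 ≤ B := (norm_nonneg _).trans (hB 0)
  obtain ⟨θ, hθ, hθg⟩ := Metric.uniformContinuous_iff.1 (hgs.uniformContinuous_of_continuous hg)
    (η / 2) (half_pos hη)
  set L : ℝ := 3 * R ^ 2 + R + 1 with hL
  have hL0 : 0 < L := by positivity
  have hRL : R ≤ L := by nlinarith [sq_nonneg R]
  have hR2L : 3 * R ^ 2 ≤ L := by linarith
  set θ₁ : ℝ := min 1 (min (θ / L) (η / (2 * (B + 1)))) with hθ₁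
  have hθ₁0 : 0 < θ₁ := lt_min zero_lt_one (lt_min (div_pos hθ hL0) (div_pos hη (by positivity)))
  filter_upwards [Metric.ball_mem_nhds (1 : ℝ) hθ₁0] with c hc z hz
  rw [mem_ball, Real.dist_eq] at hc
  have hc1 : |c - 1| < 1 := hc.trans_le (min_le_left _ _)
  have hcθ : |c - 1| < θ / L := hc.trans_le ((min_le_right _ _).trans (min_le_left _ _))
  have hcη : |c - 1| < η / (2 * (B + 1)) := hc.trans_le ((min_le_right _ _).trans (min_le_right _ _))
  rw [SuitableCompactness.mem_parabolicCylinder_zero] at hz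
  -- the dilated point stays `θ`-close
  have hdist : dist ((c ^ 2 * z.1, c • z.2) : ℝ × EuclideanSpace ℝ (Fin 3)) z < θ := by
    rw [Prod.dist_eq]
    refine max_lt ?_ ?_
    · rw [Real.dist_eq]
      have e : c ^ 2 * z.1 - z.1 = (c - 1) * ((c + 1) * z.1) := by ring
      rw [e, abs_mul, abs_mul]
      have hz1 : |z.1| ≤ R ^ 2 := by
        rw [abs_le]
        constructor <;> linarith [hz.1.1, hz.1.2]
      have hc3 : |c + 1| ≤ 3 := by
        rw [abs_le]
        constructor <;> linarith [(abs_lt.1 hc1).1, (abs_lt.1 hc1).2]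
      calc |c - 1| * (|c + 1| * |z.1|) ≤ |c - 1| * (3 * R ^ 2) := by gcongr
        _ ≤ |c - 1| * L := by gcongr
        _ < θ / L * L := mul_lt_mul_of_pos_right hcθ hL0
        _ = θ := div_mul_cancel₀ θ hL0.ne'
    · rw [dist_eq_norm]
      have e : c • z.2 - z.2 = (c - 1) • z.2 := by rw [sub_smul, one_smul]
      rw [e, norm_smul, Real.norm_eq_abs]
      calc |c - 1| * ‖z.2‖ ≤ |c - 1| * L := by gcongr; exact hz.2.le.trans hRL
        _ < θ / L * L := mul_lt_mul_of_pos_right hcθ hL0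
        _ = θ := div_mul_cancel₀ θ hL0.ne'
  have hg1 : ‖g (c ^ 2 * z.1, c • z.2) - g z‖ < η / 2 := by
    rw [← dist_eq_norm]
    exact hθg hdist
  have hg2 : ‖c • g (c ^ 2 * z.1, c • z.2) - g (c ^ 2 * z.1, c • z.2)‖ ≤ η / 2 := by
    have e : c • g (c ^ 2 * z.1, c • z.2) - g (c ^ 2 * z.1, c • z.2) =
        (c - 1) • g (c ^ 2 * z.1, c • z.2) := by rw [sub_smul, one_smul]
    rw [e, norm_smul, Real.norm_eq_abs]
    calc |c - 1| * ‖g (c ^ 2 * z.1, c • z.2)‖ ≤ η / (2 * (B + 1)) * (B + 1) :=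
          mul_le_mul hcη.le ((hB _).trans (le_add_of_nonneg_right zero_le_one)) (norm_nonneg _)
            (by positivity)
      _ = η / 2 := by field_simp
  calc ‖c • g (c ^ 2 * z.1, c • z.2) - g z‖
      ≤ ‖c • g (c ^ 2 * z.1, c • z.2) - g (c ^ 2 * z.1, c • z.2)‖ + ‖g (c ^ 2 * z.1, c • z.2) - g z‖ :=
        norm_sub_le_norm_sub_add_norm_sub _ _ _
    _ ≤ η / 2 + η / 2 := add_le_add hg2 hg1.le
    _ = η := add_halves η

/-- **S6 — the scaling orbit is continuous in `L³` on backward balls (pure analysis).**  If a field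
`u` lies in `L³(Q(0, R))` for every `R > 0`, then `c ↦ u_c` (`u_c(t,x) = c u(c²t, cx)`) is
continuous at `c = 1` in `L³(Q(0, R))` for every `R > 0`:
`‖u_c − u‖_{L³(Q(0,R))} → 0` as `c → 1`.  Truncate `u` to `Q(0, 2R)` and approximate in
`L³(volume)` by a continuous compactly supported `g`
(`MeasureTheory.MemLp.exists_hasCompactSupport_eLpNorm_sub_le`); for `c ∈ (1/2, 2)`,
`‖u_c − u‖ ≤ ‖u_c − g_c‖ + ‖g_c − g‖ + ‖g − u‖` on `Q(0,R)`, the first term is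
`c (c⁵)^{-1/3} ‖u − g‖_{L³(Q(0,cR))}` by the exact scaling law (`nsRescale_eq_zoom`,
`eLpNorm_zoom_sub_zoom`), the last is `≤ ‖f − g‖_{L³}`, and the middle one is uniformly small on
`Q(0, R)` (`rlOrbitContinuous_uniform`), then `eLpNorm_le_of_ae_bound` on the finite-measure
ball. [folklore] -/
theorem stub_rlOrbitContinuous :
    ∀ (u : ℝ → EuclideanSpace ℝ (Fin 3) → EuclideanSpace ℝ (Fin 3)),
      (∀ R : ℝ, 0 < R → MemLp (uncurry u) 3
        (volume.restrict (parabolicCylinder R (0 : ℝ × EuclideanSpace ℝ (Fin 3))))) →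
      ∀ R : ℝ, 0 < R → Tendsto (fun c : ℝ => eLpNorm (uncurry (nsRescale c u) - uncurry u) 3
        (volume.restrict (parabolicCylinder R (0 : ℝ × EuclideanSpace ℝ (Fin 3))))) (𝓝 1) (𝓝 0) := by
  intro u hu R hR
  rw [ENNReal.tendsto_nhds_zero]
  intro ε hε
  -- the constants: `K₀` bounds the scaling constant, `V = |Q(0,R)|^{1/3}`
  set K₀ : ℝ≥0∞ := ENNReal.ofReal 2 * ENNReal.ofReal 32 ^ (1 / (3 : ℝ≥0∞).toReal) with hK₀
  have hK₀top : K₀ ≠ ⊤ :=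
    ENNReal.mul_ne_top ENNReal.ofReal_ne_top
      (ENNReal.rpow_ne_top_of_nonneg (by norm_num) ENNReal.ofReal_ne_top)
  set V : ℝ≥0∞ := volume (parabolicCylinder R (0 : ℝ × EuclideanSpace ℝ (Fin 3))) ^
    (3 : ℝ≥0∞).toReal⁻¹ with hV
  have hVtop : V ≠ ⊤ := ENNReal.rpow_ne_top_of_nonneg (by norm_num)
    (SuitableCompactness.volume_parabolicCylinder_zero_ne_top R)
  set A : ℝ≥0∞ := K₀ + V + 1 with hA
  have hAtop : A ≠ ⊤ := by
    rw [hA]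
    exact ENNReal.add_ne_top.2 ⟨ENNReal.add_ne_top.2 ⟨hK₀top, hVtop⟩, ENNReal.one_ne_top⟩
  have h1A : 1 ≤ A := le_add_self
  have hA0 : A ≠ 0 := (lt_of_lt_of_le one_pos h1A).ne'
  set δ : ℝ≥0∞ := ε / 3 with hδ
  have hδ0 : δ ≠ 0 := (ENNReal.div_pos hε.ne' (by norm_num)).ne'
  set η : ℝ≥0∞ := min (δ / A) 1 with hη
  have hη0 : η ≠ 0 := (lt_min (ENNReal.div_pos hδ0 hAtop) one_pos).ne'
  have hηtop : η ≠ ⊤ := ne_top_of_le_ne_top ENNReal.one_ne_top (min_le_right _ _)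
  have hAη : A * η ≤ δ :=
    (mul_le_mul' le_rfl (min_le_left _ _)).trans_eq (ENNReal.mul_div_cancel hA0 hAtop)
  have hK₀η : K₀ * η ≤ δ :=
    (mul_le_mul' (le_add_right (le_self_add : K₀ ≤ K₀ + V)) le_rfl).trans hAη
  have hVη : V * η ≤ δ :=
    (mul_le_mul' (le_add_right (le_add_self : V ≤ K₀ + V)) le_rfl).trans hAη
  have hηδ : η ≤ δ := (le_mul_of_one_le_left bot_le h1A).trans hAη
  have hη'0 : 0 < η.toReal := ENNReal.toReal_pos hη0 hηtop
  have hofReal : ENNReal.ofReal η.toReal = η := ENNReal.ofReal_toReal hηtop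
  -- truncation to `Q(0, 2R)` and `C_c` approximation
  have hmeas : ∀ r : ℝ, MeasurableSet (parabolicCylinder r (0 : ℝ × EuclideanSpace ℝ (Fin 3))) :=
    fun r => (isOpen_parabolicCylinder _ _).measurableSet
  set f : ℝ × EuclideanSpace ℝ (Fin 3) → EuclideanSpace ℝ (Fin 3) :=
    (parabolicCylinder (2 * R) (0 : ℝ × EuclideanSpace ℝ (Fin 3))).indicator (uncurry u) with hf
  have hfL : MemLp f 3 volume := by
    rw [hf, memLp_indicator_iff_restrict (hmeas _)]
    exact hu (2 * R) (by positivity)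
  obtain ⟨g, hgs, hfg, hgc, -⟩ :=
    hfL.exists_hasCompactSupport_eLpNorm_sub_le (by norm_num : (3 : ℝ≥0∞) ≠ ⊤) hη0
  have hgm : ∀ r : ℝ, AEStronglyMeasurable g
      (volume.restrict (parabolicCylinder r (0 : ℝ × EuclideanSpace ℝ (Fin 3)))) :=
    fun r => hgc.aestronglyMeasurable
  -- on `Q(0, r) ⊆ Q(0, 2R)` the field `u` is its truncation `f`
  have huf : ∀ r : ℝ, 0 ≤ r → r ≤ 2 * R →
      (uncurry u : ℝ × EuclideanSpace ℝ (Fin 3) → EuclideanSpace ℝ (Fin 3)) =ᵐ[volume.restrict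
        (parabolicCylinder r (0 : ℝ × EuclideanSpace ℝ (Fin 3)))] f := by
    intro r hr0 hr
    filter_upwards [ae_restrict_mem (hmeas r)] with z hz
    rw [hf, indicator_of_mem (SuitableCompactness.parabolicCylinder_zero_mono hr0 hr hz)]
  -- the two eventualities in `c`
  have hcI : ∀ᶠ c : ℝ in 𝓝 1, c ∈ Ioo (1 / 2 : ℝ) 2 := Ioo_mem_nhds (by norm_num) (by norm_num)
  filter_upwards [hcI, rlOrbitContinuous_uniform hgc hgs hR hη'0] with c hc hcu
  have hc0 : 0 < c := by linarith [hc.1]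
  -- measurability of the four fields on `Q(0, R)`
  have hum : AEStronglyMeasurable (uncurry u)
      (volume.restrict (parabolicCylinder R (0 : ℝ × EuclideanSpace ℝ (Fin 3)))) := (hu R hR).1
  have hucm : AEStronglyMeasurable (uncurry (nsRescale c u))
      (volume.restrict (parabolicCylinder R (0 : ℝ × EuclideanSpace ℝ (Fin 3)))) := by
    rw [nsRescale_eq_zoom c u]
    exact (memLp_three_zoom hc0 (hu (c * R) (by positivity))).1
  have hgcc : Continuous (uncurry (nsRescale c (curry g))) := by
    show Continuous fun z : ℝ × EuclideanSpace ℝ (Fin 3) => c • g (c ^ 2 * z.1, c • z.2)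
    fun_prop
  have hgcm : AEStronglyMeasurable (uncurry (nsRescale c (curry g)))
      (volume.restrict (parabolicCylinder R (0 : ℝ × EuclideanSpace ℝ (Fin 3)))) :=
    hgcc.aestronglyMeasurable
  -- Term 1: `‖u_c − g_c‖ ≤ K₀ ‖f − g‖`
  have hT1 : eLpNorm (uncurry (nsRescale c u) - uncurry (nsRescale c (curry g))) 3
      (volume.restrict (parabolicCylinder R (0 : ℝ × EuclideanSpace ℝ (Fin 3)))) ≤ K₀ * η := by
    rw [nsRescale_eq_zoom c u, nsRescale_eq_zoom c (curry g), eLpNorm_zoom_sub_zoom u (curry g) hc0 R,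
      uncurry_curry]
    refine mul_le_mul' (rlOrbitContinuous_zoomConst_le hc) ?_
    have hcR : c * R ≤ 2 * R := by nlinarith [hc.2]
    calc eLpNorm (uncurry u - g) 3
          (volume.restrict (parabolicCylinder (c * R) (0 : ℝ × EuclideanSpace ℝ (Fin 3))))
        = eLpNorm (f - g) 3
          (volume.restrict (parabolicCylinder (c * R) (0 : ℝ × EuclideanSpace ℝ (Fin 3)))) :=
          eLpNorm_congr_ae ((huf (c * R) (by positivity) hcR).sub (ae_eq_refl g))
      _ ≤ eLpNorm (f - g) 3 volume := eLpNorm_mono_measure _ Measure.restrict_le_self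
      _ ≤ η := hfg
  -- Term 2: `‖g_c − g‖ ≤ |Q(0,R)|^{1/3} η`
  have hT2 : eLpNorm (uncurry (nsRescale c (curry g)) - g) 3
      (volume.restrict (parabolicCylinder R (0 : ℝ × EuclideanSpace ℝ (Fin 3)))) ≤ V * η := by
    have hbound : ∀ᵐ z ∂(volume.restrict (parabolicCylinder R (0 : ℝ × EuclideanSpace ℝ (Fin 3)))),
        ‖(uncurry (nsRescale c (curry g)) - g) z‖ ≤ η.toReal := by
      filter_upwards [ae_restrict_mem (hmeas R)] with z hz
      exact hcu z hz
    calc eLpNorm (uncurry (nsRescale c (curry g)) - g) 3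
          (volume.restrict (parabolicCylinder R (0 : ℝ × EuclideanSpace ℝ (Fin 3))))
        ≤ (volume.restrict (parabolicCylinder R (0 : ℝ × EuclideanSpace ℝ (Fin 3)))) univ ^
            (3 : ℝ≥0∞).toReal⁻¹ * ENNReal.ofReal η.toReal := eLpNorm_le_of_ae_bound hbound
      _ = V * η := by rw [Measure.restrict_apply_univ, hofReal]
  -- Term 3: `‖g − u‖ ≤ ‖f − g‖`
  have hT3 : eLpNorm (g - uncurry u) 3
      (volume.restrict (parabolicCylinder R (0 : ℝ × EuclideanSpace ℝ (Fin 3)))) ≤ η := by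
    calc eLpNorm (g - uncurry u) 3
          (volume.restrict (parabolicCylinder R (0 : ℝ × EuclideanSpace ℝ (Fin 3))))
        = eLpNorm (g - f) 3
          (volume.restrict (parabolicCylinder R (0 : ℝ × EuclideanSpace ℝ (Fin 3)))) :=
          eLpNorm_congr_ae ((ae_eq_refl g).sub (huf R hR.le (by linarith)))
      _ ≤ eLpNorm (g - f) 3 volume := eLpNorm_mono_measure _ Measure.restrict_le_self
      _ = eLpNorm (f - g) 3 volume := eLpNorm_sub_comm _ _ _ _
      _ ≤ η := hfg
  -- the `3ε` split
  calc eLpNorm (uncurry (nsRescale c u) - uncurry u) 3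
        (volume.restrict (parabolicCylinder R (0 : ℝ × EuclideanSpace ℝ (Fin 3))))
      = eLpNorm ((uncurry (nsRescale c u) - uncurry (nsRescale c (curry g))) +
          ((uncurry (nsRescale c (curry g)) - g) + (g - uncurry u))) 3
          (volume.restrict (parabolicCylinder R (0 : ℝ × EuclideanSpace ℝ (Fin 3)))) := by
        rw [sub_add_sub_cancel, sub_add_sub_cancel]
    _ ≤ eLpNorm (uncurry (nsRescale c u) - uncurry (nsRescale c (curry g))) 3
          (volume.restrict (parabolicCylinder R (0 : ℝ × EuclideanSpace ℝ (Fin 3)))) +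
        eLpNorm ((uncurry (nsRescale c (curry g)) - g) + (g - uncurry u)) 3
          (volume.restrict (parabolicCylinder R (0 : ℝ × EuclideanSpace ℝ (Fin 3)))) :=
        eLpNorm_add_le (hucm.sub hgcm) ((hgcm.sub (hgm R)).add ((hgm R).sub hum)) (by norm_num)
    _ ≤ eLpNorm (uncurry (nsRescale c u) - uncurry (nsRescale c (curry g))) 3
          (volume.restrict (parabolicCylinder R (0 : ℝ × EuclideanSpace ℝ (Fin 3)))) +
        (eLpNorm (uncurry (nsRescale c (curry g)) - g) 3
          (volume.restrict (parabolicCylinder R (0 : ℝ × EuclideanSpace ℝ (Fin 3)))) +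
          eLpNorm (g - uncurry u) 3
          (volume.restrict (parabolicCylinder R (0 : ℝ × EuclideanSpace ℝ (Fin 3))))) :=
        add_le_add le_rfl (eLpNorm_add_le (hgcm.sub (hgm R)) ((hgm R).sub hum) (by norm_num))
    _ ≤ K₀ * η + (V * η + η) := add_le_add hT1 (add_le_add hT2 hT3)
    _ ≤ δ + (δ + δ) := add_le_add hK₀η (add_le_add hVη hηδ)
    _ = ε := by rw [← add_assoc, hδ, ENNReal.add_thirds]

end Summit.NavierStokesRegularity.NavierStokesRegularity.Theorems
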